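import Mathlib
import HarnessLib
import Literature.MathematicalPhysics.QuantumLattice.SectorisedKernelNormPrescribedSums
import Summits.HubbardSuperconductivity.HubbardSuperconductivity.Theorems.KLProgrammeKLRegimeSplitTwoLegMomentsFromFamily
import Summits.HubbardSuperconductivity.HubbardSuperconductivity.Theorems.KLProgrammeKLRegimeEngineV8TwoLegSpaceMomentsExport
import Summits.HubbardSuperconductivity.HubbardSuperconductivity.Theorems.KLProgrammeKLRegimeEngineV8TwoLegSectorMomentsDoor
import Summits.HubbardSuperconductivity.HubbardSuperconductivity.Theorems.KLProgrammeKLRegimeEngineTowerModelDefsPow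

/-!
# Route `KLProgramme` — crux K3 ENGINE (stmt-HubbardSuperconductivity-20437 `KLRegimeEngineV17F2`), located risk #17 «(C2)-MOMENTS» (R85a)(B):
# THE PRODUCER-SIDE DOORS OF THE ORDER-`d` SPACE-MOMENT ATOM — from a PAIR TABLE of a complete family (the degree-`d` twin of r2d-p1's B2′ row),
# from a GRASSMANN DECOMPOSITION (telescoping), and from the degree-`d` tower carrier `klWtPinnedSumPow` (shell rows)
# (cell gate-hubbard-kl, seat hubbard-kl-k3c2-p3 g11; the atom/export are `…EngineV8TwoLegSpaceMomentsExport`, p618321)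

The #17 atom `TwoLegSpaceMomentAt L M Z β U μ K n d` reads the spatially OFF-DIAGONAL order-`d` pinned moment of the TRIVIAL-multiplier two-leg kernel of
`G' = 𝒱⁽ⁿ⁾[K] − 𝒩_K`; its order-`1` case is VERBATIM the `hMs` row of r2d-p1's `TwoLegFourier.twoLeg_spaceMoment_le_of_family` (stub (e) B2′).  This file gives the
producer (E1's levels package) the three algebraic doors into it, none of which chooses a supplier architecture:

* §1 **`twoLeg_spaceMomentPow_le_of_family`** (generic `G`, any COMPLETE family `Σ_ω F_ω ≡ 1`, any degree `d`): the order-`d` off-diagonal moment of the trivial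
  kernel is `≤ Σ_{ω : Fin 2 → Fin N} Ms (ω 0) (ω 1)` for a pair table `Ms` — r2d-p1's proof with `^ d`; **`twoLegSpaceMomentAt_of_family`** — the atom from a pair table
  of `G'`;
* §2 **`offDiag_spaceMomentPow_le_of_sum_decomposition`** (generic): for `G = Σ_{i ∈ I} T_i` the order-`d` moments add (`sectorisedKernel_sum`), and
  **`twoLegSpaceMomentAt_of_sum_decomposition`** — the atom with `Z = Σ_i Z_i` from per-piece moments (the telescoped supplier: slices / blocks of the flow,
  e.g. `klEffectiveAction_eq_blocked`);
* §3 **`momentWeightPow_le_mul_klScaleWtPow`** — the atom's weight against the degree-`d` tree weight of rate `r`: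
  `(1 + |Δx̃₀| + |Δx̃₁|)^d ≤ (1 + 2Λ_r⁻¹)^d · klScaleWtPow … r d (pos X)` (g9's `spaceWeight_le_two_mul_klScale_inv_mul_klScaleWt_sub_one`, `1 ≤ klScaleWt`);
  **`shellRow_spaceMomentPow_le_of_klWtPinnedSumPow`** — for ANY `T`, the family `F_J`, a spin `σ`, a pinned shell label `ω₀` and pin `x₀`, the `ω₁`-summed
  order-`d` off-diagonal moment of the `(ω₀, ω₁)`-sectorised two-leg kernels of `T` is `≤ (1 + 2Λ_r⁻¹)^d · klWtPinnedSumPow L M β μ K J r d 2 T 0 (x₀, ((ω₀,σ),+))`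
  — the SHELL ROWS of a pair/row table by name from the degree-`d` carrier (p618395); the complement rows of a completed family are the supplier's plain track.
Units check (law A of the export, `Z j·U²·(4ⁿ)^{j−1}`): a slice born at rate `r` with weighted pinned mass `∝ U²·Λ_r` contributes `(1+2Λ_r⁻¹)^d·U²Λ_r ≍ U²·Λ_r^{1−d}`,
and `Σ_{r ≤ n} Λ_r^{1−d} ≍ Λ_n^{1−d} ∝ (4ⁿ)^{d−1}` for `d ≥ 2` (order `1` n-free is class #7's standing debt, located risk #13).
Everything is proved; no definitions; nothing about the model is asserted; nothing asserts superconductivity.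
References: BGM 2006 §2.3 (2.17), §2.7 (2.70)–(2.71), §3 (3.5)–(3.6) [cite: BenfattoGiulianiMastropietro2006].
-/

noncomputable section

namespace Summit.HubbardSuperconductivity.HubbardSuperconductivity.Theorems.EngineV8

set_option linter.dupNamespace false -- summit = problem name (single-conjunct summit), D-0017

open Real Finset Literature.MathematicalPhysics.QuantumLattice Literature.Probability.LatticeModels GrassmannAlgebra
open Summit.HubbardSuperconductivity.HubbardSuperconductivity.Theorems.KLRegimeSplit
open Summit.HubbardSuperconductivity.HubbardSuperconductivity.Theorems.KLProgrammeLegKernels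
open Summit.HubbardSuperconductivity.HubbardSuperconductivity.Theorems.TwoLegFourier

variable {L M : ℕ} [NeZero L] [NeZero M]

/-! ## §1 The order-`d` off-diagonal moment from a pair table of a complete family -/

omit [NeZero L] [NeZero M] in
/-- The two-leg label string `((0,σ),+),((0,σ),−)` as a spin/charge string. -/
private theorem twoLeg_string_eq_sc (σ : Fin 2) :
    (![(((0 : Fin 1), σ), 0), (((0 : Fin 1), σ), 1)] : Fin 2 → SectorLeg 1) =
      fun i => (((0 : Fin 1), ((![(σ, 0), (σ, 1)] : Fin 2 → Fin 2 × Fin 2) i).1), ((![(σ, 0), (σ, 1)] : Fin 2 → Fin 2 × Fin 2) i).2) := by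
  funext i; fin_cases i <;> rfl

omit [NeZero L] [NeZero M] in
/-- The family two-leg label string `((ω₀,σ),+),((ω₁,σ),−)` as a spin/charge string with labels `![ω₀, ω₁]`. -/
private theorem twoLeg_family_string_eq_sc {N : ℕ} (σ : Fin 2) (ω : Fin 2 → Fin N) :
    (fun i => ((ω i, ((![(σ, 0), (σ, 1)] : Fin 2 → Fin 2 × Fin 2) i).1), ((![(σ, 0), (σ, 1)] : Fin 2 → Fin 2 × Fin 2) i).2)) =
      (![((ω 0, σ), 0), ((ω 1, σ), 1)] : Fin 2 → SectorLeg N) := by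
  funext i; fin_cases i <;> rfl

omit [NeZero M] in
/-- **THE ORDER-`d` OFF-DIAGONAL SPACE MOMENT FROM A PAIR TABLE** (generic `G`, complete family): if `Σ_ω F_ω(k) = 1` at every `k` and the
`(ω₀,ω₁)`-sectorised two-leg kernels of `G` have pinned off-diagonal order-`d` space moments `≤ Ms ω₀ ω₁` (both spins, every pin), then the trivial-multiplier
kernel has order-`d` moment `≤ Σ_{ω : Fin 2 → Fin N} Ms (ω 0) (ω 1)` — r2d-p1's `twoLeg_spaceMoment_le_of_family` with `^ d`.
[cite: BenfattoGiulianiMastropietro2006, §2.3 (2.17), §2.7 (2.70)-(2.71)] -/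
theorem twoLeg_spaceMomentPow_le_of_family {β : ℝ} (hβ : 0 ≤ β) (G : HubbardGrassmann L M) {N : ℕ} {F : Fin N → FreqMomentum L M → ℂ}
    (hF : ∀ k, ∑ ω, F ω k = 1) (d : ℕ) {Ms : Fin N → Fin N → ℝ}
    (hMs : ∀ (ω₀ ω₁ : Fin N) (σ : Fin 2) (x₀ : SpaceTimeIdx L M), imagTimeWeight β M *
      ∑ x ∈ (univ : Finset (Fin 2 → SpaceTimeIdx L M)).filter (fun x => x 0 = x₀ ∧ (x 1).2 ≠ (x 0).2),
        (1 + ((((x 1).2 - (x 0).2) 0).valMinAbs.natAbs : ℝ) + ((((x 1).2 - (x 0).2) 1).valMinAbs.natAbs : ℝ)) ^ d *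
          ‖sectorisedKernel L M β F G 2 (![((ω₀, σ), 0), ((ω₁, σ), 1)] : Fin 2 → SectorLeg N) x‖ ≤ Ms ω₀ ω₁)
    (σ : Fin 2) (x₀ : SpaceTimeIdx L M) :
    imagTimeWeight β M *
      ∑ x ∈ (univ : Finset (Fin 2 → SpaceTimeIdx L M)).filter (fun x => x 0 = x₀ ∧ (x 1).2 ≠ (x 0).2),
        (1 + ((((x 1).2 - (x 0).2) 0).valMinAbs.natAbs : ℝ) + ((((x 1).2 - (x 0).2) 1).valMinAbs.natAbs : ℝ)) ^ d *
          ‖sectorisedKernel L M β (trivialMultiplier L M) G 2 (![((0, σ), 0), ((0, σ), 1)] : Fin 2 → SectorLeg 1) x‖ ≤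
      ∑ ω : Fin 2 → Fin N, Ms (ω 0) (ω 1) := by
  have hε : 0 ≤ imagTimeWeight β M := imagTimeWeight_nonneg hβ M
  rw [twoLeg_string_eq_sc σ]
  have h := sum_wt_norm_sectorisedKernel_trivialMultiplier_le_sum_family β hF G 2 (![(σ, 0), (σ, 1)] : Fin 2 → Fin 2 × Fin 2)
    ((univ : Finset (Fin 2 → SpaceTimeIdx L M)).filter (fun x => x 0 = x₀ ∧ (x 1).2 ≠ (x 0).2))
    (w := fun x => (1 + ((((x 1).2 - (x 0).2) 0).valMinAbs.natAbs : ℝ) + ((((x 1).2 - (x 0).2) 1).valMinAbs.natAbs : ℝ)) ^ d)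
    (fun x _ => by positivity)
  refine (mul_le_mul_of_nonneg_left h hε).trans ?_
  rw [mul_sum]
  refine sum_le_sum fun ω _ => ?_
  rw [twoLeg_family_string_eq_sc σ ω]
  exact hMs (ω 0) (ω 1) σ x₀

omit [NeZero M] in
/-- **THE #17 ATOM FROM A PAIR TABLE**: for `G' = klEffectiveAction … K klE0 n − counterQuadratic … K`, a complete family and pair budgets `Ms ω₀ ω₁` at order `d`,
`TwoLegSpaceMomentAt L M (Σ_ω Ms (ω 0) (ω 1)) β U μ K n d`. -/
theorem twoLegSpaceMomentAt_of_family {β : ℝ} (hβ : 0 ≤ β) (U μ : ℝ) (K : TrigPolyC4v) (n d : ℕ) {N : ℕ} {F : Fin N → FreqMomentum L M → ℂ}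
    (hF : ∀ k, ∑ ω, F ω k = 1) {Ms : Fin N → Fin N → ℝ}
    (hMs : ∀ (ω₀ ω₁ : Fin N) (σ : Fin 2) (x₀ : SpaceTimeIdx L M), imagTimeWeight β M *
      ∑ x ∈ (univ : Finset (Fin 2 → SpaceTimeIdx L M)).filter (fun x => x 0 = x₀ ∧ (x 1).2 ≠ (x 0).2),
        (1 + ((((x 1).2 - (x 0).2) 0).valMinAbs.natAbs : ℝ) + ((((x 1).2 - (x 0).2) 1).valMinAbs.natAbs : ℝ)) ^ d *
          ‖sectorisedKernel L M β F (KLProgrammeLegKernels.klEffectiveAction L M β U μ K klE0 n - counterQuadratic L M β K) 2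
            (![((ω₀, σ), 0), ((ω₁, σ), 1)] : Fin 2 → SectorLeg N) x‖ ≤ Ms ω₀ ω₁) :
    TwoLegSpaceMomentAt L M (∑ ω : Fin 2 → Fin N, Ms (ω 0) (ω 1)) β U μ K n d :=
  fun σ x₀ => twoLeg_spaceMomentPow_le_of_family hβ _ hF d hMs σ x₀

/-! ## §2 Telescoping: the moments of a Grassmann sum -/

omit [NeZero M] in
/-- **ORDER-`d` MOMENTS ADD OVER A GRASSMANN DECOMPOSITION** (generic): if every piece `T i` has pinned off-diagonal order-`d` moment `≤ Z i` (both spins,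
every pin), then `Σ_{i ∈ I} T i` has moment `≤ Σ_{i ∈ I} Z i`. -/
theorem offDiag_spaceMomentPow_le_of_sum_decomposition {β : ℝ} (hβ : 0 ≤ β) {ι : Type*} (I : Finset ι) (T : ι → HubbardGrassmann L M) (d : ℕ)
    {Z : ι → ℝ}
    (hZ : ∀ i ∈ I, ∀ (σ : Fin 2) (x₀ : SpaceTimeIdx L M), imagTimeWeight β M *
      ∑ x ∈ (univ : Finset (Fin 2 → SpaceTimeIdx L M)).filter (fun x => x 0 = x₀ ∧ (x 1).2 ≠ (x 0).2),
        (1 + ((((x 1).2 - (x 0).2) 0).valMinAbs.natAbs : ℝ) + ((((x 1).2 - (x 0).2) 1).valMinAbs.natAbs : ℝ)) ^ d *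
          ‖sectorisedKernel L M β (trivialMultiplier L M) (T i) 2 (![((0, σ), 0), ((0, σ), 1)] : Fin 2 → SectorLeg 1) x‖ ≤ Z i)
    (σ : Fin 2) (x₀ : SpaceTimeIdx L M) :
    imagTimeWeight β M *
      ∑ x ∈ (univ : Finset (Fin 2 → SpaceTimeIdx L M)).filter (fun x => x 0 = x₀ ∧ (x 1).2 ≠ (x 0).2),
        (1 + ((((x 1).2 - (x 0).2) 0).valMinAbs.natAbs : ℝ) + ((((x 1).2 - (x 0).2) 1).valMinAbs.natAbs : ℝ)) ^ d *
          ‖sectorisedKernel L M β (trivialMultiplier L M) (∑ i ∈ I, T i) 2 (![((0, σ), 0), ((0, σ), 1)] : Fin 2 → SectorLeg 1) x‖ ≤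
      ∑ i ∈ I, Z i := by
  have hε : 0 ≤ imagTimeWeight β M := imagTimeWeight_nonneg hβ M
  set A := (univ : Finset (Fin 2 → SpaceTimeIdx L M)).filter (fun x => x 0 = x₀ ∧ (x 1).2 ≠ (x 0).2) with hA
  set s : Fin 2 → SectorLeg 1 := ![((0, σ), 0), ((0, σ), 1)] with hs
  set w : (Fin 2 → SpaceTimeIdx L M) → ℝ := fun x =>
    (1 + ((((x 1).2 - (x 0).2) 0).valMinAbs.natAbs : ℝ) + ((((x 1).2 - (x 0).2) 1).valMinAbs.natAbs : ℝ)) ^ d with hw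
  have hw0 : ∀ x, 0 ≤ w x := fun x => by rw [hw]; positivity
  -- pointwise: the kernel of the sum is the sum of the kernels
  have hpt : ∀ x, w x * ‖sectorisedKernel L M β (trivialMultiplier L M) (∑ i ∈ I, T i) 2 s x‖ ≤
      ∑ i ∈ I, w x * ‖sectorisedKernel L M β (trivialMultiplier L M) (T i) 2 s x‖ := by
    intro x
    rw [sectorisedKernel_sum, Finset.sum_apply, Finset.sum_apply, ← mul_sum]
    exact mul_le_mul_of_nonneg_left (norm_sum_le _ _) (hw0 x)
  calc imagTimeWeight β M * ∑ x ∈ A, w x * ‖sectorisedKernel L M β (trivialMultiplier L M) (∑ i ∈ I, T i) 2 s x‖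
      ≤ imagTimeWeight β M * ∑ x ∈ A, ∑ i ∈ I, w x * ‖sectorisedKernel L M β (trivialMultiplier L M) (T i) 2 s x‖ :=
        mul_le_mul_of_nonneg_left (sum_le_sum fun x _ => hpt x) hε
    _ = ∑ i ∈ I, imagTimeWeight β M * ∑ x ∈ A, w x * ‖sectorisedKernel L M β (trivialMultiplier L M) (T i) 2 s x‖ := by
        rw [sum_comm, mul_sum]
    _ ≤ ∑ i ∈ I, Z i := sum_le_sum fun i hi => hZ i hi σ x₀

omit [NeZero M] in
/-- **THE #17 ATOM FROM A DECOMPOSITION OF `𝒱⁽ⁿ⁾[K] − 𝒩_K`**: if `klEffectiveAction … K klE0 n − counterQuadratic … K = Σ_{i ∈ I} T i` (e.g. scale-`0` separated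
action plus the blocked increments of the flow) and each piece has order-`d` off-diagonal moment `≤ Z i`, then `TwoLegSpaceMomentAt L M (Σ_i Z i) β U μ K n d`. -/
theorem twoLegSpaceMomentAt_of_sum_decomposition {β : ℝ} (hβ : 0 ≤ β) (U μ : ℝ) (K : TrigPolyC4v) (n d : ℕ) {ι : Type*} (I : Finset ι)
    (T : ι → HubbardGrassmann L M)
    (hdec : KLProgrammeLegKernels.klEffectiveAction L M β U μ K klE0 n - counterQuadratic L M β K = ∑ i ∈ I, T i) {Z : ι → ℝ}
    (hZ : ∀ i ∈ I, ∀ (σ : Fin 2) (x₀ : SpaceTimeIdx L M), imagTimeWeight β M *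
      ∑ x ∈ (univ : Finset (Fin 2 → SpaceTimeIdx L M)).filter (fun x => x 0 = x₀ ∧ (x 1).2 ≠ (x 0).2),
        (1 + ((((x 1).2 - (x 0).2) 0).valMinAbs.natAbs : ℝ) + ((((x 1).2 - (x 0).2) 1).valMinAbs.natAbs : ℝ)) ^ d *
          ‖sectorisedKernel L M β (trivialMultiplier L M) (T i) 2 (![((0, σ), 0), ((0, σ), 1)] : Fin 2 → SectorLeg 1) x‖ ≤ Z i) :
    TwoLegSpaceMomentAt L M (∑ i ∈ I, Z i) β U μ K n d := by
  intro σ x₀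
  rw [hdec]
  exact offDiag_spaceMomentPow_le_of_sum_decomposition hβ I T d hZ σ x₀

/-! ## §3 From the degree-`d` tower carrier: the atom's weight against `klScaleWtPow`, and the shell rows -/

omit [NeZero L] [NeZero M] in
/-- The atom's spatial weight in absolute-value form: `((z.natAbs : ℕ) : ℝ) = |((z : ℤ) : ℝ)|` for a centred representative. -/
private theorem natAbs_cast_eq_abs_cast (z : ℤ) : ((z.natAbs : ℕ) : ℝ) = |((z : ℤ) : ℝ)| := by
  rw [Nat.cast_natAbs, Int.cast_abs]

/-- **THE ATOM'S WEIGHT AGAINST THE DEGREE-`d` TREE WEIGHT OF RATE `r`**: for a lattice two-string `X` (positions × labels),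
`(1 + |Δx̃₀| + |Δx̃₁|)^d ≤ (1 + 2Λ_r⁻¹)^d · klScaleWtPow L M β r d (pos X)` (`0 ≤ β`). -/
theorem momentWeightPow_le_mul_klScaleWtPow {β : ℝ} (hβ : 0 ≤ β) (r d : ℕ) {Ns : ℕ} (X : Fin 2 → SpaceTimeIdx L M × SectorLeg Ns) :
    (1 + (((((X 1).1.2 - (X 0).1.2) 0).valMinAbs.natAbs : ℕ) : ℝ) + (((((X 1).1.2 - (X 0).1.2) 1).valMinAbs.natAbs : ℕ) : ℝ)) ^ d ≤
      (1 + 2 * (klScale klE0 r)⁻¹) ^ d * klScaleWtPow L M β r d ((univ.image X).image (latticeLegPos (2 * (2 * M)))) := by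
  have hΛ := klth_klScale_pos r
  set W := klScaleWt L M β r ((univ.image X).image (latticeLegPos (2 * (2 * M)))) with hW
  have hW1 : 1 ≤ W := one_le_klScaleWt L M β r _
  -- the space weight in g9's orientation and absolute-value form
  have hs := spaceWeight_le_two_mul_klScale_inv_mul_klScaleWt_sub_one (L := L) (M := M) hβ r X
  have hneg : (X 1).1.2 - (X 0).1.2 = -((X 0).1.2 - (X 1).1.2) := by abel
  have h0 : (((((X 1).1.2 - (X 0).1.2) 0).valMinAbs.natAbs : ℕ) : ℝ) = |(((((X 0).1.2 - (X 1).1.2) 0).valMinAbs : ℤ) : ℝ)| := by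
    rw [hneg, Pi.neg_apply, ZMod.natAbs_valMinAbs_neg, natAbs_cast_eq_abs_cast]
  have h1 : (((((X 1).1.2 - (X 0).1.2) 1).valMinAbs.natAbs : ℕ) : ℝ) = |(((((X 0).1.2 - (X 1).1.2) 1).valMinAbs : ℤ) : ℝ)| := by
    rw [hneg, Pi.neg_apply, ZMod.natAbs_valMinAbs_neg, natAbs_cast_eq_abs_cast]
  have hbase : 1 + (((((X 1).1.2 - (X 0).1.2) 0).valMinAbs.natAbs : ℕ) : ℝ) + (((((X 1).1.2 - (X 0).1.2) 1).valMinAbs.natAbs : ℕ) : ℝ) ≤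
      (1 + 2 * (klScale klE0 r)⁻¹) * W := by
    rw [h0, h1]
    have hinv : 0 ≤ (klScale klE0 r)⁻¹ := inv_nonneg.2 hΛ.le
    nlinarith
  have hb0 : 0 ≤ 1 + (((((X 1).1.2 - (X 0).1.2) 0).valMinAbs.natAbs : ℕ) : ℝ) + (((((X 1).1.2 - (X 0).1.2) 1).valMinAbs.natAbs : ℕ) : ℝ) := by
    positivity
  calc _ ≤ ((1 + 2 * (klScale klE0 r)⁻¹) * W) ^ d := pow_le_pow_left₀ hb0 hbase d
    _ = (1 + 2 * (klScale klE0 r)⁻¹) ^ d * klScaleWtPow L M β r d ((univ.image X).image (latticeLegPos (2 * (2 * M)))) := by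
        rw [mul_pow, hW, klScaleWt_pow_eq]

/-- **THE SHELL ROWS FROM THE DEGREE-`d` CARRIER**: for ANY Grassmann element `T`, the family `F_J = klAnisoFamily … K klE0 J`, a rate `r`, a degree `d`, a spin `σ`,
a pinned shell label `ω₀` and pin `x₀`, the `ω₁`-summed order-`d` off-diagonal pinned moment of the `(ω₀,ω₁)`-sectorised two-leg kernels of `T` is at most
`(1 + 2Λ_r⁻¹)^d · klWtPinnedSumPow L M β μ K J r d 2 T 0 (x₀, ((ω₀,σ),+))`. [cite: BenfattoGiulianiMastropietro2006, §3 (3.5)-(3.6)] -/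
theorem shellRow_spaceMomentPow_le_of_klWtPinnedSumPow {β : ℝ} (hβ : 0 ≤ β) (μ : ℝ) (K : TrigPolyC4v) (J r d : ℕ) (T : HubbardGrassmann L M)
    (σ : Fin 2) (ω₀ : Fin (sectorCount J)) (x₀ : SpaceTimeIdx L M) :
    imagTimeWeight β M *
      ∑ x ∈ (univ : Finset (Fin 2 → SpaceTimeIdx L M)).filter (fun x => x 0 = x₀ ∧ (x 1).2 ≠ (x 0).2),
        (1 + ((((x 1).2 - (x 0).2) 0).valMinAbs.natAbs : ℝ) + ((((x 1).2 - (x 0).2) 1).valMinAbs.natAbs : ℝ)) ^ d *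
          ∑ ω₁ : Fin (sectorCount J), ‖sectorisedKernel L M β (klAnisoFamily L M β μ K klE0 J) T 2
            (![((ω₀, σ), 0), ((ω₁, σ), 1)] : Fin 2 → SectorLeg (sectorCount J)) x‖ ≤
      (1 + 2 * (klScale klE0 r)⁻¹) ^ d * klWtPinnedSumPow L M β μ K J r d 2 T 0 (x₀, ((ω₀, σ), 0)) := by
  have hε : 0 ≤ imagTimeWeight β M := imagTimeWeight_nonneg hβ M
  have hc : 0 ≤ (1 + 2 * (klScale klE0 r)⁻¹) ^ d := by have := klth_klScale_pos r; positivity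
  set F := klAnisoFamily L M β μ K klE0 J with hF
  -- the integrand of the carrier, as a function of the labelled two-string
  set f : (Fin 2 → SpaceTimeIdx L M × SectorLeg (sectorCount J)) → ℝ := fun X =>
    (1 + 2 * (klScale klE0 r)⁻¹) ^ d * (klScaleWtPow L M β r d ((univ.image X).image (latticeLegPos (2 * (2 * M)))) *
      ‖kernel ℂ (ExteriorAlgebra.map (Matrix.toLin' (sectorAnalysisMatrix L M β F)) T) 2 X‖) with hf
  have hf0 : ∀ X, 0 ≤ f X := fun X => by
    rw [hf]; have := klth_klScale_pos r; have := one_le_klScaleWtPow L M β r d ((univ.image X).image (latticeLegPos (2 * (2 * M)))); positivity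
  -- (1) drop the off-diagonal restriction and bound each string term by the carrier's integrand
  have h1 : ∑ x ∈ (univ : Finset (Fin 2 → SpaceTimeIdx L M)).filter (fun x => x 0 = x₀ ∧ (x 1).2 ≠ (x 0).2),
        (1 + ((((x 1).2 - (x 0).2) 0).valMinAbs.natAbs : ℝ) + ((((x 1).2 - (x 0).2) 1).valMinAbs.natAbs : ℝ)) ^ d *
          ∑ ω₁ : Fin (sectorCount J), ‖sectorisedKernel L M β F T 2 (![((ω₀, σ), 0), ((ω₁, σ), 1)] : Fin 2 → SectorLeg (sectorCount J)) x‖ ≤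
      ∑ x ∈ (univ : Finset (Fin 2 → SpaceTimeIdx L M)).filter (fun x => x 0 = x₀), ∑ ω₁ : Fin (sectorCount J),
        f (fun i => (x i, (![((ω₀, σ), 0), ((ω₁, σ), 1)] : Fin 2 → SectorLeg (sectorCount J)) i)) := by
    refine (sum_le_sum_of_subset_of_nonneg (filter_subset_filter _ subset_rfl |>.trans (fun x hx => by
      simp only [mem_filter, mem_univ, true_and] at hx ⊢; exact hx.1)) fun x _ _ => by positivity).trans (sum_le_sum fun x _ => ?_)
    rw [mul_sum]
    refine sum_le_sum fun ω₁ _ => ?_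
    set X : Fin 2 → SpaceTimeIdx L M × SectorLeg (sectorCount J) := fun i => (x i, (![((ω₀, σ), 0), ((ω₁, σ), 1)] : Fin 2 → SectorLeg _) i)
      with hX
    have hwt := momentWeightPow_le_mul_klScaleWtPow (L := L) (M := M) hβ r d X
    have hX0 : (X 0).1 = x 0 := rfl
    have hX1 : (X 1).1 = x 1 := rfl
    rw [hX0, hX1] at hwt
    have hker : ‖sectorisedKernel L M β F T 2 (![((ω₀, σ), 0), ((ω₁, σ), 1)] : Fin 2 → SectorLeg (sectorCount J)) x‖ =
        ‖kernel ℂ (ExteriorAlgebra.map (Matrix.toLin' (sectorAnalysisMatrix L M β F)) T) 2 X‖ := by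
      rw [hX, hF, kernel_map_sectorAnalysis_string]
    rw [hker, hf]
    simp only
    rw [← mul_assoc]
    exact mul_le_mul_of_nonneg_right hwt (norm_nonneg _)
  -- (2) the labelled strings inject into the pinned fibre of the carrier
  have h2 := sum_sector_string_le_sum_pinned f hf0 σ ω₀ x₀
  -- (3) assemble with the carrier's definition
  have hcar : imagTimeWeight β M * ∑ X ∈ univ.filter (fun X : Fin 2 → SpaceTimeIdx L M × SectorLeg (sectorCount J) => X 0 = (x₀, ((ω₀, σ), 0))), f X =
      (1 + 2 * (klScale klE0 r)⁻¹) ^ d * klWtPinnedSumPow L M β μ K J r d 2 T 0 (x₀, ((ω₀, σ), 0)) := by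
    rw [klWtPinnedSumPow, hf, ← mul_sum]
    simp only [Nat.reduceSub, pow_one]
    ring
  calc _ ≤ imagTimeWeight β M * ∑ x ∈ (univ : Finset (Fin 2 → SpaceTimeIdx L M)).filter (fun x => x 0 = x₀), ∑ ω₁ : Fin (sectorCount J),
          f (fun i => (x i, (![((ω₀, σ), 0), ((ω₁, σ), 1)] : Fin 2 → SectorLeg (sectorCount J)) i)) := mul_le_mul_of_nonneg_left h1 hε
    _ ≤ imagTimeWeight β M * ∑ X ∈ univ.filter (fun X : Fin 2 → SpaceTimeIdx L M × SectorLeg (sectorCount J) => X 0 = (x₀, ((ω₀, σ), 0))), f X :=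
        mul_le_mul_of_nonneg_left h2 hε
    _ = _ := hcar

/-! ## §4 (appended, same seat) The unit-step telescope: the atom from the scale-`0` base and the flow's increments -/

omit [NeZero M] in
/-- **Telescoping the separated action over unit steps**: `𝒱⁽ⁿ⁾[K] − 𝒩_K = (𝒱⁽⁰⁾[K] − 𝒩_K) + Σ_{j<n} (𝒱⁽ʲ⁺¹⁾[K] − 𝒱⁽ʲ⁾[K])`. -/
theorem klEffectiveAction_sub_counter_eq_base_add_sum_incr (β U μ : ℝ) (K : TrigPolyC4v) (n : ℕ) :
    KLProgrammeLegKernels.klEffectiveAction L M β U μ K klE0 n - counterQuadratic L M β K =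
      (KLProgrammeLegKernels.klEffectiveAction L M β U μ K klE0 0 - counterQuadratic L M β K) +
        ∑ j ∈ range n, (KLProgrammeLegKernels.klEffectiveAction L M β U μ K klE0 (j + 1) - KLProgrammeLegKernels.klEffectiveAction L M β U μ K klE0 j) := by
  rw [Finset.sum_range_sub (fun j => KLProgrammeLegKernels.klEffectiveAction L M β U μ K klE0 j)]
  abel

omit [NeZero M] in
/-- **THE #17 ATOM FROM THE SCALE-`0` BASE AND THE UNIT-STEP INCREMENTS** (the producer's last line, cf. W3's `twoLegGridFlowMomentsAt_of_wtIncrements_of_sum_le`):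
if the separated scale-`0` action has order-`d` off-diagonal pinned moment `≤ Z₀` and every unit-step increment `𝒱⁽ʲ⁺¹⁾[K] − 𝒱⁽ʲ⁾[K]`, `j < n`, has moment `≤ Z j` (both
spins, every pin; each from a pair table / the degree-`d` carrier by §1/§3), then `TwoLegSpaceMomentAt L M (Z₀ + Σ_{j<n} Z j) β U μ K n d`. -/
theorem twoLegSpaceMomentAt_of_unitIncrements {β : ℝ} (hβ : 0 ≤ β) (U μ : ℝ) (K : TrigPolyC4v) (n d : ℕ) {Z₀ : ℝ} {Z : ℕ → ℝ}
    (h0 : ∀ (σ : Fin 2) (x₀ : SpaceTimeIdx L M), imagTimeWeight β M *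
      ∑ x ∈ (univ : Finset (Fin 2 → SpaceTimeIdx L M)).filter (fun x => x 0 = x₀ ∧ (x 1).2 ≠ (x 0).2),
        (1 + ((((x 1).2 - (x 0).2) 0).valMinAbs.natAbs : ℝ) + ((((x 1).2 - (x 0).2) 1).valMinAbs.natAbs : ℝ)) ^ d *
          ‖sectorisedKernel L M β (trivialMultiplier L M)
              (KLProgrammeLegKernels.klEffectiveAction L M β U μ K klE0 0 - counterQuadratic L M β K) 2
            (![((0, σ), 0), ((0, σ), 1)] : Fin 2 → SectorLeg 1) x‖ ≤ Z₀)
    (hincr : ∀ j < n, ∀ (σ : Fin 2) (x₀ : SpaceTimeIdx L M), imagTimeWeight β M *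
      ∑ x ∈ (univ : Finset (Fin 2 → SpaceTimeIdx L M)).filter (fun x => x 0 = x₀ ∧ (x 1).2 ≠ (x 0).2),
        (1 + ((((x 1).2 - (x 0).2) 0).valMinAbs.natAbs : ℝ) + ((((x 1).2 - (x 0).2) 1).valMinAbs.natAbs : ℝ)) ^ d *
          ‖sectorisedKernel L M β (trivialMultiplier L M)
              (KLProgrammeLegKernels.klEffectiveAction L M β U μ K klE0 (j + 1) - KLProgrammeLegKernels.klEffectiveAction L M β U μ K klE0 j) 2
            (![((0, σ), 0), ((0, σ), 1)] : Fin 2 → SectorLeg 1) x‖ ≤ Z j) :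
    TwoLegSpaceMomentAt L M (Z₀ + ∑ j ∈ range n, Z j) β U μ K n d := by
  -- index the base as `0` and the increment `j` as `j + 1`
  set T : ℕ → HubbardGrassmann L M := fun i => Nat.casesOn i
    (KLProgrammeLegKernels.klEffectiveAction L M β U μ K klE0 0 - counterQuadratic L M β K)
    (fun j => KLProgrammeLegKernels.klEffectiveAction L M β U μ K klE0 (j + 1) - KLProgrammeLegKernels.klEffectiveAction L M β U μ K klE0 j) with hT
  set Z' : ℕ → ℝ := fun i => Nat.casesOn i Z₀ (fun j => Z j) with hZ'
  have hdec : KLProgrammeLegKernels.klEffectiveAction L M β U μ K klE0 n - counterQuadratic L M β K = ∑ i ∈ range (n + 1), T i := by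
    rw [Finset.sum_range_succ', klEffectiveAction_sub_counter_eq_base_add_sum_incr β U μ K n, add_comm]
    rfl
  have hsum : Z₀ + ∑ j ∈ range n, Z j = ∑ i ∈ range (n + 1), Z' i := by
    rw [Finset.sum_range_succ', add_comm]
    rfl
  rw [hsum]
  refine twoLegSpaceMomentAt_of_sum_decomposition hβ U μ K n d (range (n + 1)) T hdec fun i hi σ x₀ => ?_
  cases i with
  | zero => exact h0 σ x₀
  | succ j => exact hincr j (by simpa [Finset.mem_range, Nat.succ_lt_succ_iff] using hi) σ x₀

end Summit.HubbardSuperconductivity.HubbardSuperconductivity.Theorems.EngineV8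

end
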